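import Summits.BirchSwinnertonDyer.BirchSwinnertonDyer.Theorems.AlignedTransportAtTwoMainConjectureOfRankZeroBSDAtTwoFineRoadArchSquare
import HarnessLib

/-!
# Route `AlignedTransportAtTwo`, crux C2 `MainConjectureOfRankZeroBSDAtTwo` (stmt-BirchSwinnertonDyer-22298):
# road (b″) — `X₀(E/K_∞)` is unique up to `Λ`-isomorphism, so «∀ Yd» statements are choice-free

Width seat `bsd-line-att-p4` g2 (cell `bsd-f1-sign2`; `--supports` stmt-BirchSwinnertonDyer-22298; closes nothing).
HONEST FRAMING: THEOREMS ONLY — no definition, no named fact, no `sorry`; BSD is NOT proved by any of this.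
Companion of `…FineRoadArchSquare` (§1 there: the restriction `X ↠ X₀` on the pinned duals).

The road-(b″) statements of the line (`selmerDual_mu_eq_zero_of_roadB2_arch_two` / `…_square_two`, the
`μ`-inequality of the tightness pass) quantify over ALL pinned dual fine Selmer data
`Yd : W.FineSelmerDualData κ γ`, while their proofs and the typed Kato witness produce the CANONICAL datum
`W.fineSelmerDualData κ hγ` (`KatoFineSelmerDualProofs`). The two are interchangeable: any two pinned data are
`Λ`-isomorphic by `Y'.toDual⁻¹ ∘ Y.toDual`, which is `Λ`-linear because the `Λ`-action of EVERY pinned datum read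
through `toDual` is the canonical one (`SignedKatoOffTwo.FineRestriction.fineDual_toDual_smul`) — the fine copy of
the tree's `SelmerDualData.exists_linearEquiv` (`IwasawaSelmerDualUniquenessProofs`). Hence local lengths and
`μ`-invariants of all pinned fine data agree.

* `exists_fineDual_linearEquiv` — `∃ e : Y.X ≃ₗ[Λ] Y'.X, Y'.toDual ∘ e = Y.toDual`;
* `lengthAt_fineDual_eq`, `muInvariant_fineDual_eq`, `lengthAt_fineDual_eq_canonical`.

References: R. Greenberg, LNM 1716 (1999), §1 (p. 60: the `Λ`-module structure of Pontryagin duals is forced);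
J. Coates, R. Sujatha, Math. Ann. 331 (2005), §3.
-/

set_option autoImplicit false
-- the Theorems namespace of this sub repeats the summit name by design (D-0017 nested layout)
set_option linter.dupNamespace false

noncomputable section

open scoped Classical

namespace Summit.BirchSwinnertonDyer.BirchSwinnertonDyer.Theorems.AlignedTransportAtTwoFineRoad.FineRestrict

open WeierstrassCurve Literature.NumberTheory.EllipticCurves Literature.NumberTheory.EllipticCurves.IwasawaDual
  Literature.NumberTheory.EllipticCurves.Module Literature.NumberTheory.GaloisRepresentations ZpExtension
  Summit.BirchSwinnertonDyer.Rank1Residual.X1.MuLambda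

universe u

variable {K : Type u} [Field K] [NumberField K] (W : WeierstrassCurve K) {p : ℕ} [Fact p.Prime]
  (κ : ZpExtension K p) {γ : Field.absoluteGaloisGroup K}

/-- **Uniqueness of the dual fine Selmer datum**: for `γ` a topological generator, two pinned data
`Y Y' : W.FineSelmerDualData κ γ` have `Λ`-ISOMORPHIC modules, by the comparison `Y'.toDual⁻¹ ∘ Y.toDual` —
`Λ`-linear because both actions read through `toDual` are the canonical one
(`SignedKatoOffTwo.FineRestriction.fineDual_toDual_smul`). The fine copy of `SelmerDualData.exists_linearEquiv`.
[cite: GreenbergLNM1716, §1 (after Conj. 1.3)] [cite: CoatesSujatha2005, §3] -/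
theorem exists_fineDual_linearEquiv (hγ : κ.IsTopGenerator γ) (Y Y' : W.FineSelmerDualData κ γ) :
    ∃ e : Y.X ≃ₗ[IwasawaAlgebra p] Y'.X, ∀ x, Y'.toDual (e x) = Y.toDual x := by
  set eY := AddEquiv.ofBijective Y.toDual Y.bijective with heY
  set eY' := AddEquiv.ofBijective Y'.toDual Y'.bijective with heY'
  have h1 : ∀ χ, Y'.toDual (eY'.symm χ) = χ := fun χ ↦ eY'.apply_symm_apply χ
  have h2 : ∀ χ, Y.toDual (eY.symm χ) = χ := fun χ ↦ eY.apply_symm_apply χ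
  refine ⟨{ toFun := fun x ↦ eY'.symm (Y.toDual x)
            invFun := fun x' ↦ eY.symm (Y'.toDual x')
            map_add' := fun x y ↦ by rw [map_add, map_add]
            map_smul' := fun f x ↦ ?_
            left_inv := fun x ↦ ?_
            right_inv := fun x' ↦ ?_ }, fun x ↦ h1 _⟩
  · apply Y'.bijective.injective
    rw [RingHom.id_apply, h1, SignedKatoOffTwo.FineRestriction.fineDual_toDual_smul W κ hγ Y',
      h1, SignedKatoOffTwo.FineRestriction.fineDual_toDual_smul W κ hγ Y]
  · apply Y.bijective.injective
    rw [h2, h1]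
  · apply Y'.bijective.injective
    rw [h1, h2]

/-- The local lengths of two dual fine Selmer data agree at every prime of `Λ`. [cite: CoatesSujatha2005, §3] -/
theorem lengthAt_fineDual_eq (hγ : κ.IsTopGenerator γ) (Y Y' : W.FineSelmerDualData κ γ)
    (𝔭 : PrimeSpectrum (IwasawaAlgebra p)) :
    lengthAt (IwasawaAlgebra p) Y.X 𝔭 = lengthAt (IwasawaAlgebra p) Y'.X 𝔭 := by
  obtain ⟨e, -⟩ := exists_fineDual_linearEquiv W κ hγ Y Y'
  exact lengthAt_eq_of_linearEquiv e 𝔭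

/-- The `μ`-invariants of two dual fine Selmer data agree (`μ` is the `toNat` of the local length at `(p)`).
[cite: CoatesSujatha2005, §3 (Conjecture A)] -/
theorem muInvariant_fineDual_eq (hγ : κ.IsTopGenerator γ) (Y Y' : W.FineSelmerDualData κ γ) :
    muInvariant p Y.X = muInvariant p Y'.X := by
  let 𝔭 : PrimeSpectrum (IwasawaAlgebra p) :=
    ⟨IwasawaAlgebra.augIdealP p, IwasawaAlgebra.isPrime_augIdealP_holds p⟩
  rw [muInvariant_eq_toNat_lengthAt p Y.X 𝔭 rfl, muInvariant_eq_toNat_lengthAt p Y'.X 𝔭 rfl,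
    lengthAt_fineDual_eq W κ hγ Y Y' 𝔭]

/-- Every dual fine Selmer datum is `Λ`-isomorphic to the CANONICAL one `W.fineSelmerDualData κ hγ`
(`KatoFineSelmerDualProofs`), so «for all `Yd`» and «for the canonical `Yd`» are interchangeable in the
road-(b″) statements. [cite: GreenbergLNM1716, §1 (after Conj. 1.3)] -/
theorem lengthAt_fineDual_eq_canonical (hγ : κ.IsTopGenerator γ) (Y : W.FineSelmerDualData κ γ)
    (𝔭 : PrimeSpectrum (IwasawaAlgebra p)) :
    lengthAt (IwasawaAlgebra p) Y.X 𝔭 = lengthAt (IwasawaAlgebra p) (W.fineSelmerDualData κ hγ).X 𝔭 :=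
  lengthAt_fineDual_eq W κ hγ Y (W.fineSelmerDualData κ hγ) 𝔭

end Summit.BirchSwinnertonDyer.BirchSwinnertonDyer.Theorems.AlignedTransportAtTwoFineRoad.FineRestrict

end
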